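import Mathlib.Analysis.SpecialFunctions.Integrals.Basic
import Mathlib.Analysis.SpecialFunctions.Complex.Log
import Mathlib.MeasureTheory.Integral.Pi
import HarnessLib

/-!
# Orthogonality of the characters `e^{i⟨k, θ⟩}` on the box `(−π, π]^ι` and Parseval for trigonometric polynomials

Topic `Analysis/Fourier`; namespace `Literature.Analysis.Fourier.TorusBox`.  Theorems only (no definition, no named
fact, no instance, no `sorry`); Mathlib only.  For a finite index type `ι` and the box `B = (−π, π]^ι ⊂ ℝ^ι` with
Lebesgue measure:

* `integral_Ioc_cexp_int_mul` — `∫_{(−π,π]} e^{ikx} dx = 2π` if `k = 0` and `0` otherwise (`k ∈ ℤ`);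
* `integral_box_cexp_sum_int_mul` — `∫_B e^{i Σ_j k_j θ_j} dθ = (2π)^{|ι|}` if `k = 0` and `0` otherwise (`k ∈ ℤ^ι`),
  by Fubini over the factors (Mathlib `integral_fintype_prod_eq_prod`);
* `integral_box_conj_trigPoly_mul_trigPoly` / `integral_box_norm_sq_trigPoly` — **Parseval for trigonometric
  polynomials**: `∫_B |Σ_{p ∈ P} c_p e^{i⟨p,θ⟩}|² dθ = (2π)^{|ι|} Σ_{p ∈ P} |c_p|²`.

These are the orthogonality relations of the characters of the torus `(ℝ/2πℤ)^ι` in the angle chart used by the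
tree's Weyl integration formula for `U(n)` (`RepresentationTheory/CompactGroups/WeylIntegrationTorus`,
`…Unitary`: integrals over `θ ∈ (−π, π]ⁿ` of functions of `diag(e^{iθ})`); Katznelson, *An Introduction to Harmonic
Analysis*, Ch. I §1.5 (orthogonality of exponentials) and §5 (Parseval) [Katznelson2004]; Bröcker–tom Dieck II (8.4)
(orthogonality of the characters of a torus) [BrockerTomDieck1985].  Written for the `hodgecm-mathlib` cell (road HC,
node H4b), generic.

## References
* Y. Katznelson, *An Introduction to Harmonic Analysis*, 3rd ed. (2004), Ch. I §1.5, §5 [Katznelson2004].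
* T. Bröcker, T. tom Dieck, *Representations of Compact Lie Groups*, GTM 98 (1985), II (8.4) [BrockerTomDieck1985].
-/

set_option autoImplicit false

noncomputable section

open MeasureTheory Complex Set
open scoped Real ComplexConjugate

namespace Literature.Analysis.Fourier.TorusBox

/-! ### One variable -/

/-- **`∫_{(−π,π]} e^{ikx} dx = 2π·[k = 0]`** for an integer frequency `k`. [cite: Katznelson2004, I §1.5] -/
theorem integral_Ioc_cexp_int_mul (k : ℤ) :
    ∫ x in Ioc (-π) π, cexp ((k : ℂ) * (x : ℂ) * I) = if k = 0 then ((2 * π : ℝ) : ℂ) else 0 := by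
  split_ifs with hk
  · subst hk
    simp only [Int.cast_zero, zero_mul, Complex.exp_zero]
    rw [setIntegral_const, measureReal_def, Real.volume_Ioc, ENNReal.toReal_ofReal (by linarith [Real.pi_pos]),
      Complex.real_smul, mul_one]
    push_cast
    ring
  · rw [← intervalIntegral.integral_of_le (by linarith [Real.pi_pos] : -π ≤ π)]
    have hc : (k : ℂ) * I ≠ 0 := mul_ne_zero (Int.cast_ne_zero.mpr hk) I_ne_zero
    have hfun : (fun x : ℝ => cexp ((k : ℂ) * (x : ℂ) * I)) = fun x : ℝ => cexp ((k : ℂ) * I * (x : ℂ)) := by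
      funext x; ring_nf
    rw [hfun, integral_exp_mul_complex hc]
    have hper : cexp ((k : ℂ) * I * ((π : ℝ) : ℂ)) = cexp ((k : ℂ) * I * ((-π : ℝ) : ℂ)) := by
      rw [Complex.exp_eq_exp_iff_exists_int]
      exact ⟨k, by push_cast; ring⟩
    rw [hper, sub_self, zero_div]

/-! ### The box `(−π, π]^ι` -/

variable {ι : Type*} [Fintype ι]

/-- `e^{i Σ_j k_j θ_j} = ∏_j e^{i k_j θ_j}`. [cite: Katznelson2004, I §1.5] -/
theorem cexp_sum_mul_I (k : ι → ℤ) (θ : ι → ℝ) :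
    cexp ((∑ j, (k j : ℂ) * (θ j : ℂ)) * I) = ∏ j, cexp ((k j : ℂ) * (θ j : ℂ) * I) := by
  rw [Finset.sum_mul, Complex.exp_sum]

/-- The Lebesgue measure restricted to the box is the product of the restricted one-dimensional measures.
[cite: Katznelson2004, I §1.5] -/
theorem volume_restrict_box :
    (volume : Measure (ι → ℝ)).restrict (Set.pi univ fun _ : ι => Ioc (-π) π) =
      Measure.pi fun _ : ι => (volume : Measure ℝ).restrict (Ioc (-π) π) := by
  rw [volume_pi, Measure.restrict_pi_pi]

/-- **Orthogonality of the characters of the torus in the angle chart**: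
`∫_{(−π,π]^ι} e^{i Σ_j k_j θ_j} dθ = (2π)^{|ι|}·[k = 0]`. [cite: Katznelson2004, I §1.5] [cite: BrockerTomDieck1985, II (8.4)] -/
theorem integral_box_cexp_sum_int_mul (k : ι → ℤ) :
    ∫ θ in Set.pi univ fun _ : ι => Ioc (-π) π, cexp ((∑ j, (k j : ℂ) * (θ j : ℂ)) * I) =
      if k = 0 then ((2 * π : ℝ) : ℂ) ^ Fintype.card ι else 0 := by
  simp_rw [cexp_sum_mul_I]
  rw [volume_restrict_box, integral_fintype_prod_eq_prod (𝕜 := ℂ) (fun j (x : ℝ) => cexp ((k j : ℂ) * (x : ℂ) * I))]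
  simp_rw [integral_Ioc_cexp_int_mul]
  split_ifs with hk
  · subst hk
    simp only [Pi.zero_apply, if_true, Finset.prod_const, Finset.card_univ]
  · obtain ⟨j, hj⟩ : ∃ j, k j ≠ 0 := by
      by_contra h
      push Not at h
      exact hk (funext h)
    exact Finset.prod_eq_zero (Finset.mem_univ j) (if_neg hj)

/-- A trigonometric monomial is continuous in `θ`. [cite: Katznelson2004, I §1.5] -/
theorem continuous_cexp_sum_mul_I (k : ι → ℤ) :
    Continuous fun θ : ι → ℝ => cexp ((∑ j, (k j : ℂ) * (θ j : ℂ)) * I) := by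
  refine Complex.continuous_exp.comp ((continuous_finsetSum _ fun j _ => ?_).mul continuous_const)
  exact continuous_const.mul (Complex.continuous_ofReal.comp (continuous_apply j))

/-- Continuous functions are integrable on the (bounded) box. [cite: Katznelson2004, I §1.5] -/
theorem integrableOn_box_of_continuous {F : Type*} [NormedAddCommGroup F] {f : (ι → ℝ) → F} (hf : Continuous f) :
    IntegrableOn f (Set.pi univ fun _ : ι => Ioc (-π) π) := by
  have hK : IsCompact (Set.pi univ fun _ : ι => Icc (-π) π) := isCompact_univ_pi fun _ => isCompact_Icc
  exact (hf.continuousOn.integrableOn_compact hK).mono_set (Set.pi_mono fun _ _ => Ioc_subset_Icc_self)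

/-- `conj(e^{i⟨p,θ⟩}) · e^{i⟨q,θ⟩} = e^{i⟨q − p, θ⟩}`. [cite: Katznelson2004, I §1.5] -/
theorem conj_cexp_mul_cexp (p q : ι → ℤ) (θ : ι → ℝ) :
    conj (cexp ((∑ j, (p j : ℂ) * (θ j : ℂ)) * I)) * cexp ((∑ j, (q j : ℂ) * (θ j : ℂ)) * I) =
      cexp ((∑ j, ((q - p) j : ℂ) * (θ j : ℂ)) * I) := by
  rw [← Complex.exp_conj, ← Complex.exp_add]
  congr 1
  simp only [map_mul, map_sum, Complex.conj_ofReal, Complex.conj_I, map_intCast, Pi.sub_apply, Int.cast_sub,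
    sub_mul, Finset.sum_sub_distrib]
  ring

/-- **Parseval for trigonometric polynomials, sesquilinear form**: for a finite set of frequencies `P ⊆ ℤ^ι` and
coefficients `c, c'`, `∫_B conj(Σ_p c_p e^{i⟨p,θ⟩}) · (Σ_q c'_q e^{i⟨q,θ⟩}) dθ = (2π)^{|ι|} Σ_{p ∈ P} conj(c_p) c'_p`.
[cite: Katznelson2004, I §5] [cite: BrockerTomDieck1985, II (8.4)] -/
theorem integral_box_conj_trigPoly_mul_trigPoly (P : Finset (ι → ℤ)) (c c' : (ι → ℤ) → ℂ) :
    ∫ θ in Set.pi univ fun _ : ι => Ioc (-π) π,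
        conj (∑ p ∈ P, c p * cexp ((∑ j, (p j : ℂ) * (θ j : ℂ)) * I)) *
          ∑ q ∈ P, c' q * cexp ((∑ j, (q j : ℂ) * (θ j : ℂ)) * I) =
      ((2 * π : ℝ) : ℂ) ^ Fintype.card ι * ∑ p ∈ P, conj (c p) * c' p := by
  -- expand the product of the two sums
  have hexp : ∀ θ : ι → ℝ,
      conj (∑ p ∈ P, c p * cexp ((∑ j, (p j : ℂ) * (θ j : ℂ)) * I)) *
          ∑ q ∈ P, c' q * cexp ((∑ j, (q j : ℂ) * (θ j : ℂ)) * I) =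
        ∑ p ∈ P, ∑ q ∈ P, conj (c p) * c' q * cexp ((∑ j, ((q - p) j : ℂ) * (θ j : ℂ)) * I) := by
    intro θ
    rw [map_sum, Finset.sum_mul_sum]
    refine Finset.sum_congr rfl fun p _ => Finset.sum_congr rfl fun q _ => ?_
    rw [map_mul, mul_mul_mul_comm, conj_cexp_mul_cexp, mul_assoc]
  simp_rw [hexp]
  have hint : ∀ p q : ι → ℤ, Integrable (fun θ : ι → ℝ =>
      conj (c p) * c' q * cexp ((∑ j, ((q - p) j : ℂ) * (θ j : ℂ)) * I))
      ((volume : Measure (ι → ℝ)).restrict (Set.pi univ fun _ : ι => Ioc (-π) π)) := fun p q =>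
    (integrableOn_box_of_continuous (continuous_const.mul (continuous_cexp_sum_mul_I (q - p)))).integrable
  rw [integral_finsetSum _ fun p _ => integrable_finsetSum _ fun q _ => hint p q, Finset.mul_sum]
  refine Finset.sum_congr rfl fun p hp => ?_
  rw [integral_finsetSum _ fun q _ => hint p q]
  have hq : ∀ q ∈ P, ∫ θ in Set.pi univ fun _ : ι => Ioc (-π) π,
      conj (c p) * c' q * cexp ((∑ j, ((q - p) j : ℂ) * (θ j : ℂ)) * I) =
        if q = p then ((2 * π : ℝ) : ℂ) ^ Fintype.card ι * (conj (c p) * c' p) else 0 := by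
    intro q _
    rw [integral_const_mul, integral_box_cexp_sum_int_mul (q - p)]
    by_cases h : q = p
    · subst h; simp only [sub_self, if_true]; ring
    · rw [if_neg (sub_ne_zero.mpr h), if_neg h, mul_zero]
  rw [Finset.sum_congr rfl hq, Finset.sum_ite_eq' P p, if_pos hp]

/-- **Parseval for trigonometric polynomials**: `∫_B |Σ_{p ∈ P} c_p e^{i⟨p,θ⟩}|² dθ = (2π)^{|ι|} Σ_{p ∈ P} |c_p|²`
(real form). [cite: Katznelson2004, I §5] [cite: BrockerTomDieck1985, II (8.4)] -/
theorem integral_box_norm_sq_trigPoly (P : Finset (ι → ℤ)) (c : (ι → ℤ) → ℂ) :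
    ∫ θ in Set.pi univ fun _ : ι => Ioc (-π) π, ‖∑ p ∈ P, c p * cexp ((∑ j, (p j : ℂ) * (θ j : ℂ)) * I)‖ ^ 2 =
      (2 * π) ^ Fintype.card ι * ∑ p ∈ P, ‖c p‖ ^ 2 := by
  have h := integral_box_conj_trigPoly_mul_trigPoly P c c
  simp_rw [Complex.conj_mul', ← Complex.ofReal_pow] at h
  rw [integral_complex_ofReal] at h
  exact_mod_cast h

end Literature.Analysis.Fourier.TorusBox

end
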